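import Summits.QuantumAdvantage.QuantumAdvantage.Theses.CubicForrelation
import Summits.QuantumAdvantage.QuantumAdvantage.Theorems.NearExactIsExact.Negative.ValueWitnesses

/-!
# Value witness for `NearExactIsExact` (stmt-QuantumAdvantage-14043): `Φ = 57/64` at `n = 12` (the `𝔽₈` chain)

Negative-side support (B2b-3 disprover seat `b2b-cforr-disprove`, 2026-08-18).  HONEST FRAMING: the value of this file is a
CERTIFICATE (an exactly evaluated forrelation value of an explicit cubic pair), not summit progress.

The pair: over `𝔽₈ = 𝔽₂[t]/(t³+t+1)` with coordinates `y₁ = (x₀,x₁,x₂)`, `y₂ = (x₃,x₄,x₅)`, `u = (x₆,x₇,x₈)`,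
`w = (x₉,x₁₀,x₁₁)` (bit `i` of a field element = coefficient of `tᶦ`),
`gC = Tr(y₁·y₂⁶) + Tr(y₂·u·w)` (the "𝔽₈ chain" of `Cruxes/NearExactIsExact/NOTES.md` §FINDINGS 6; cubic since `y₂⁶ =
y₂²·y₂⁴`),
and `fC` = the cubic sign pattern of its Walsh spectrum (soft Reed–Muller decoding of `W_gC`; it is again
Maiorana–McFarland-shaped).
`W_gC ∈ {0 (504×), ±64 (3584×), ±512 (8×)}`, so `gC` is NOT bent, its Walsh capacity `2^{-18} Σ|W_gC|` equals `57/64`,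
and the
capacity is attained by a cubic sign pattern: `Φ(fC, gC) = 57/64` (`forrelation_fC_gC`).  This is the largest
forrelation value of a
non-exact cubic pair known at `n = 12` (records: `13/16` (8), `7/8` (10), `57/64` (12), `15/16` (16), all in this directory);
`57/64 < 15/16`, so it does not move the global threshold bound `nearExactIsExact_iff_ge` — it pins the `n = 12` entry of the
per-`n` value table asked for by the B2b programme.

`native_decide` evaluates the forrelation sum by the fast Walsh–Hadamard checker `fsumL` of `ValueWitnesses.lean`: the
file is
`computational`.  References: Carlet 2021 §6.1 (Maiorana–McFarland functions); Aaronson–Ambainis 2018 §1.1.1 (forrelation).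
-/

set_option linter.dupNamespace false -- D-0017: single-problem summit ⇒ `QuantumAdvantage.QuantumAdvantage` by design

namespace Summit.QuantumAdvantage.QuantumAdvantage.Theorems.NearExactIsExact.Negative.F8Chain

open Literature.Computability.QuantumComplexity
open Summit.QuantumAdvantage.QuantumAdvantage.Theorems.SignedExactSliceIsLift.StubMoebius (isDegLeFun_xor isDegLeFun_and)
open Summit.QuantumAdvantage.QuantumAdvantage.Theorems.NearExactIsExact.Negative.SmallCases (fsumL forrelation_eq_fsumL)

/-- `gC = Tr(y₁y₂⁶) + Tr(y₂uw)` over `𝔽₈` (algebraic normal form, 21 monomials). [cite: Carlet2020, §6.1] -/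
def gC (x : Fin (6 + 6) → Bool) : Bool :=
  xor
    (xor
      (xor
        (xor (x 5 && (x 8 && x 11)) (x 4 && (x 8 && x 11)))
        (xor (x 5 && (x 7 && x 11)) (xor (x 3 && (x 7 && x 11)) (x 4 && (x 6 && x 11)))))
      (xor
        (xor (x 5 && (x 8 && x 10)) (x 3 && (x 8 && x 10)))
        (xor (x 4 && (x 7 && x 10)) (xor (x 5 && (x 6 && x 10)) (x 4 && (x 8 && x 9))))))
    (xor
      (xor
        (xor (x 5 && (x 7 && x 9)) (x 3 && (x 6 && x 9)))
        (xor (x 0 && (x 4 && x 5)) (xor (x 1 && (x 3 && x 5)) (x 2 && (x 3 && x 4)))))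
      (xor
        (xor (x 2 && x 5) (xor (x 1 && x 5) (x 0 && x 5)))
        (xor (x 1 && x 4) (xor (x 0 && x 4) (x 0 && x 3)))))


/-- `fC` = the cubic sign pattern of `W_gC` (algebraic normal form, 21 monomials). [cite: Carlet2020, §6.1] -/
def fC (x : Fin (6 + 6) → Bool) : Bool :=
  xor
    (xor
      (xor
        (xor (x 2 && (x 8 && x 11)) (x 1 && (x 7 && x 11)))
        (xor (x 0 && (x 7 && x 11)) (xor (x 1 && (x 6 && x 11)) (x 1 && (x 8 && x 10)))))
      (xor
        (xor (x 0 && (x 8 && x 10)) (x 2 && (x 7 && x 10)))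
        (xor (x 1 && (x 7 && x 10)) (xor (x 2 && (x 6 && x 10)) (x 1 && (x 8 && x 9))))))
    (xor
      (xor
        (xor (x 2 && (x 7 && x 9)) (x 0 && (x 6 && x 9)))
        (xor (x 0 && (x 1 && x 5)) (xor (x 0 && (x 2 && x 4)) (x 1 && (x 2 && x 3)))))
      (xor
        (xor (x 2 && x 5) (xor (x 1 && x 5) (x 1 && x 4)))
        (xor (x 2 && x 3) (xor (x 1 && x 3) (x 0 && x 3)))))


/-- A cubic monomial has degree `≤ 3`. [cite: Carlet2020, §2.2.1 Def. 6] -/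
theorem isDegLeFun_mon3 (i j k : Fin (6 + 6)) :
    IsDegLeFun 3 (fun x : Fin (6 + 6) → Bool => (x i && (x j && x k))) :=
  isDegLeFun_and (a := 1) (b := 2) (isDegLeFun_apply i le_rfl)
    (isDegLeFun_and (a := 1) (b := 1) (isDegLeFun_apply j le_rfl) (isDegLeFun_apply k le_rfl))

/-- A quadratic monomial has degree `≤ 3`. [cite: Carlet2020, §2.2.1 Def. 6] -/
theorem isDegLeFun_mon2 (i j : Fin (6 + 6)) :
    IsDegLeFun 3 (fun x : Fin (6 + 6) → Bool => (x i && x j)) :=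
  (isDegLeFun_and (a := 1) (b := 1) (isDegLeFun_apply i le_rfl) (isDegLeFun_apply j le_rfl)).mono (by norm_num)

/-- `gC` is cubic. [cite: Carlet2020, §2.2.1 Def. 6] -/
theorem isDegLeFun_gC : IsDegLeFun 3 gC := by
  unfold gC
  repeat (first
    | exact isDegLeFun_mon3 _ _ _
    | exact isDegLeFun_mon2 _ _
    | exact isDegLeFun_apply _ (by norm_num)
    | apply isDegLeFun_xor)

/-- `fC` is cubic. [cite: Carlet2020, §2.2.1 Def. 6] -/
theorem isDegLeFun_fC : IsDegLeFun 3 fC := by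
  unfold fC
  repeat (first
    | exact isDegLeFun_mon3 _ _ _
    | exact isDegLeFun_mon2 _ _
    | exact isDegLeFun_apply _ (by norm_num)
    | apply isDegLeFun_xor)

/-- The forrelation sum of the `𝔽₈`-chain pair: `57/64 · 2¹⁸ = 233472`. [folklore] -/
theorem fsumL_fC_gC : fsumL (6 + 6) fC gC = 233472 := by native_decide

/-- **`Φ(fC, gC) = 57/64`** at `n = 12`. [folklore] -/
theorem forrelation_fC_gC : forrelation fC gC = 57 / 64 := by
  rw [forrelation_eq_fsumL 6 fC gC, fsumL_fC_gC]; norm_num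

/-- **A non-exact cubic pair with `Φ = 57/64` on `12` bits.** [folklore] -/
theorem exists_cubic_pair_twelve_57_64 :
    ∃ f g : (Fin (6 + 6) → Bool) → Bool, IsDegLeFun 3 f ∧ IsDegLeFun 3 g ∧ forrelation f g = 57 / 64 :=
  ⟨fC, gC, isDegLeFun_fC, isDegLeFun_gC, forrelation_fC_gC⟩

/-- **No threshold below `57/64` isolates exactness at `n = 12`** (witness `(fC, gC)`). [folklore] -/
theorem not_isolation_below_57_64_twelve {θ : ℝ} (hθ : θ < 57 / 64) :
    ¬ (∀ f g : (Fin (6 + 6) → Bool) → Bool, IsDegLeFun 3 f → IsDegLeFun 3 g →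
        θ < forrelation f g → forrelation f g = 1) := by
  intro h
  have h1 := h fC gC isDegLeFun_fC isDegLeFun_gC (by rw [forrelation_fC_gC]; exact hθ)
  rw [forrelation_fC_gC] at h1
  norm_num at h1

end Summit.QuantumAdvantage.QuantumAdvantage.Theorems.NearExactIsExact.Negative.F8Chain
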